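import Summits.QuantumFields.YangMills.Theorems.BalabanUVNodesN15NeumannCubeMajorant
import HarnessLib

/-!
# Route «BalabanUVNodes» (K3⁷), node N15 = NE2, -a lane, PROGRAMME N file N-IIIc: ENTRY 1 OF THE NEUMANN CUBE PROPAGATOR — gradients commute with the images up to a
# backward shift and a sign; the block majorant `χ_□ ∘ ∇_ν ∘ G(□) ≤ 1_□(y)·1_□(y′)·β·e^{−δ|y−y′|_T}` AT `U ≡ 1`

Cell `pub-ymgap`, seat `pub-ymgap-dag-n15-a` (KNIT-BY-NAME, g19; D-0062; chair R424 venue; `bears_on: R4∕N15`); `--kind proof --supports stmt-QuantumFields-20544 --as helper`.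
Sequel of N-IIIb `…N15NeumannCubeMajorant` (entry 0).  CONSUMER: dag-n15-c's two-spacing gluing — the commutator letter `[Δ_a, M_h]G(□)` (FILE 46 `…GluingCommutator`, Leibniz on
`[Δ, M_h]`) reads the cube propagator's ENTRY 1 (`∇G(□)`, (1.110) «∇G» shape) localized to the cube; this file supplies it for the Neumann cube propagator.

WHAT.  §11: `gradImg ν T` (`∇_ν` seen through the image `T`: itself if `ν ∉ T`, `−S_{−ν}∇_ν` if `ν ∈ T`); `imgPt_add_unitVec_of_(not_)mem` (`img_T` is affine, flipping the reflected
coordinates); ★ `symbOp_sD_comp_reflSet_of_not_mem` (`∇_ν ∘ R_T = R_T ∘ ∇_ν`), ★ `symbOp_sD_comp_reflSet_of_mem` (`∇_ν ∘ R_T = −R_T ∘ S_{−ν} ∘ ∇_ν`), `symbOp_sD_comp_reflSet`,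
`mulOp_comp_sD_comp_symOp_comp` (the `2^{d+1}`-term expansion), `hasMaj_gradImg_comp` (cost `e^{δ}` for the backward shift, `hasMaj_bshiftV_comp`), ★★★ **`hasMaj_chiCube_grad_neumannCubeG`**:
for odd `L > 1`, `a > 0` there are `δ, β > 0` with, for EVERY `m, K ≥ 1`, cube position `c` and direction `ν`,
`HasMaj (ofBlocks g blkFine) (ofBlocks g blkFine) (mulOp χ_□ ∘ₗ ρ(sD_ν L^K) ∘ₗ neumannCubeG (MP …) (L^K) c (L^m) a) (fun y y' => ind □ y * ind □ y' * (β * exp (−δ·|y−y′|_T)))`,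
`β = 2^{d+1}·C·e^{2δ₀}` — from the (1.110) entry «∇G» of the torus propagator (`hasMaj_entries110`) by the method of images.
HONEST FRAMING.  Block-majorant bookkeeping over the landed (1.110) torus letters; no new analytic estimate; `U ≡ 1` torus MODEL on the doubled-cube family; the two-grid defects of the cube
propagators (`hDG`, CENTRE-anchored pairing) remain the sequel; nothing of [B6] (2.38)–(2.40) asserted; N15 NOT discharged (object-bound; NE2⁺ NOT PRINTED); counts UNMOVED (typed 28∕28 ·
discharged 5∕27); one finite torus — NOT continuum ∕ ℝ⁴ ∕ OS ∕ mass gap ∕ Clay.  One plumbing def (`gradImg`); every theorem is [folklore] lattice algebra ∕ bookkeeping.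
-/

noncomputable section

open scoped BigOperators Matrix
open Finset

namespace Summit.QuantumFields.YangMills.BalabanUVNodes.N15.TwoGrid

open Literature.MathematicalPhysics.QuantumFieldTheory.Balaban1983to89
open Literature.MathematicalPhysics.QuantumFieldTheory.Balaban1983to89.B5Prop11Plancherel (Tor fine unitVec)
open Literature.MathematicalPhysics.QuantumFieldTheory.Balaban1983to89.B5Block118 (up bpt)
open Literature.MathematicalPhysics.QuantumFieldTheory.Balaban1983to89.B6Prop26Gluing (mulOp mulOp_apply ind ind_nonneg ind_le_one)
open Literature.MathematicalPhysics.QuantumFieldTheory.King1986.Torus (blockOf tdistT)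
open Literature.MathematicalPhysics.QuantumFieldTheory.Balaban1983to89.B11SectG (BlockNorm HasMaj)
open Literature.MathematicalPhysics.QuantumFieldTheory.Balaban1983to89.B6UnitTorusCarrier (unitTorusGeo)
open Literature.MathematicalPhysics.QuantumFieldTheory.Balaban1983to89.B5SiteBridgeP12 (MP)
open Summit.QuantumFields.YangMills.BalabanUVNodes.N15.VectorPiece (blkFine bshiftV bshiftV_apply hasMaj_bshiftV_comp)

variable {d : ℕ}

/-! ## §11 Entry 1: the gradient of the cube propagator — gradients commute with the images up to a backward shift and a sign -/

section Gradient

variable (M : Fin (d + 1) → ℕ) [∀ μ, NeZero (M μ)] (n : ℕ) [NeZero n] (c : Tor M)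

/-- the gradient seen through the image `T`: `∇_ν` if `ν ∉ T`, `−S_{−ν}∇_ν` if `ν ∈ T` (a reflected direction reverses the difference quotient). [folklore] -/
def gradImg (ν : Fin (d + 1)) (T : Finset (Fin (d + 1))) (cc : ℝ) : (Tor (fine n M) × Fin (d + 1) → ℝ) →ₗ[ℝ] (Tor (fine n M) × Fin (d + 1) → ℝ) :=
  if ν ∈ T then -(bshiftV M n ν ∘ₗ symbOp M n (sD M n ν cc)) else symbOp M n (sD M n ν cc)

variable {M n c}

omit [∀ μ, NeZero (M μ)] [NeZero n] in
/-- `img_T(x + e_ν) = img_T x + e_ν` for an unreflected direction. [folklore] -/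
theorem imgPt_add_unitVec_of_not_mem {T : Finset (Fin (d + 1))} {ν : Fin (d + 1)} (hν : ν ∉ T) (x : Tor (fine n M)) :
    imgPt M n c T (x + unitVec (fine n M) ν) = imgPt M n c T x + unitVec (fine n M) ν := by
  funext κ
  by_cases h : κ ∈ T
  · have hne : κ ≠ ν := fun h' => hν (h' ▸ h)
    simp [imgPt, h, unitVec, Pi.single_eq_of_ne hne]
  · simp [imgPt, h]

omit [∀ μ, NeZero (M μ)] [NeZero n] in
/-- `img_T(x + e_ν) = img_T x − e_ν` for a reflected direction. [folklore] -/
theorem imgPt_add_unitVec_of_mem {T : Finset (Fin (d + 1))} {ν : Fin (d + 1)} (hν : ν ∈ T) (x : Tor (fine n M)) :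
    imgPt M n c T (x + unitVec (fine n M) ν) = imgPt M n c T x - unitVec (fine n M) ν := by
  funext κ
  by_cases h : κ = ν
  · subst h; simp only [imgPt, if_pos hν, Pi.add_apply, Pi.sub_apply, unitVec, Pi.single_eq_same]; ring
  · by_cases h2 : κ ∈ T
    · simp [imgPt, h2, unitVec, Pi.single_eq_of_ne h]
    · simp [imgPt, h2, unitVec, Pi.single_eq_of_ne h]

omit [∀ μ, NeZero (M μ)] [NeZero n] in
/-- ★ `∇_ν ∘ R_T = R_T ∘ ∇_ν` for an unreflected direction `ν ∉ T`. [folklore] -/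
theorem symbOp_sD_comp_reflSet_of_not_mem {T : Finset (Fin (d + 1))} {ν : Fin (d + 1)} (hν : ν ∉ T) (cc : ℝ) :
    symbOp M n (sD M n ν cc) ∘ₗ reflSet M n c T = reflSet M n c T ∘ₗ symbOp M n (sD M n ν cc) := by
  refine LinearMap.ext fun A => funext fun b => ?_
  obtain ⟨x, μ⟩ := b
  rw [LinearMap.comp_apply, LinearMap.comp_apply, symbOp_sD_apply, reflSet_apply, reflSet_apply, reflSet_apply, symbOp_sD_apply]
  simp only [sgnT, imgBond, imgPt_add_unitVec_of_not_mem hν, add_sub_right_comm]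
  ring

omit [∀ μ, NeZero (M μ)] [NeZero n] in
/-- ★ `∇_ν ∘ R_T = −R_T ∘ S_{−ν} ∘ ∇_ν` for a reflected direction `ν ∈ T`. [folklore] -/
theorem symbOp_sD_comp_reflSet_of_mem {T : Finset (Fin (d + 1))} {ν : Fin (d + 1)} (hν : ν ∈ T) (cc : ℝ) :
    symbOp M n (sD M n ν cc) ∘ₗ reflSet M n c T = -(reflSet M n c T ∘ₗ bshiftV M n ν ∘ₗ symbOp M n (sD M n ν cc)) := by
  refine LinearMap.ext fun A => funext fun b => ?_
  obtain ⟨x, μ⟩ := b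
  rw [LinearMap.neg_apply, Pi.neg_apply, LinearMap.comp_apply, LinearMap.comp_apply, LinearMap.comp_apply, symbOp_sD_apply, reflSet_apply, reflSet_apply,
    reflSet_apply, bshiftV_apply, symbOp_sD_apply]
  simp only [sgnT, imgBond, imgPt_add_unitVec_of_mem hν, sub_right_comm _ (unitVec (fine n M) ν), sub_add_cancel]
  ring

omit [∀ μ, NeZero (M μ)] [NeZero n] in
/-- ★ `∇_ν ∘ R_T = R_T ∘ ∇_ν^{(T)}`. [folklore] -/
theorem symbOp_sD_comp_reflSet (ν : Fin (d + 1)) (T : Finset (Fin (d + 1))) (cc : ℝ) :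
    symbOp M n (sD M n ν cc) ∘ₗ reflSet M n c T = reflSet M n c T ∘ₗ gradImg M n ν T cc := by
  unfold gradImg
  split_ifs with h
  · rw [symbOp_sD_comp_reflSet_of_mem h, LinearMap.comp_neg]
  · exact symbOp_sD_comp_reflSet_of_not_mem h cc

omit [∀ μ, NeZero (M μ)] [NeZero n] in
/-- `χ ∘ ∇_ν ∘ Sym ∘ X` is the sum over the images of `χ ∘ R_T ∘ (∇_ν^{(T)} ∘ X)`. [folklore] -/
theorem mulOp_comp_sD_comp_symOp_comp {F₁ : Type} [AddCommGroup F₁] [Module ℝ F₁] (X : F₁ →ₗ[ℝ] (Tor (fine n M) × Fin (d + 1) → ℝ))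
    (χ : Tor (fine n M) × Fin (d + 1) → ℝ) (ν : Fin (d + 1)) (cc : ℝ) :
    mulOp χ ∘ₗ symbOp M n (sD M n ν cc) ∘ₗ symOp M n c ∘ₗ X
      = ∑ Ts ∈ (Finset.univ : Finset (Fin (d + 1))).powerset, mulOp χ ∘ₗ reflSet M n c Ts ∘ₗ (gradImg M n ν Ts cc ∘ₗ X) := by
  have h : ∀ Ts : Finset (Fin (d + 1)), mulOp χ ∘ₗ symbOp M n (sD M n ν cc) ∘ₗ reflSet M n c Ts ∘ₗ X = mulOp χ ∘ₗ reflSet M n c Ts ∘ₗ (gradImg M n ν Ts cc ∘ₗ X) := by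
    intro Ts
    refine LinearMap.ext fun f => ?_
    have := LinearMap.congr_fun (symbOp_sD_comp_reflSet (c := c) ν Ts cc) (X f)
    simp only [LinearMap.comp_apply] at this ⊢
    rw [this]
  refine LinearMap.ext fun f => ?_
  simp only [symOp, LinearMap.comp_apply, LinearMap.sum_apply, map_sum]
  refine Finset.sum_congr rfl fun Ts _ => ?_
  have := LinearMap.congr_fun (h Ts) f
  simpa only [LinearMap.comp_apply] using this

variable {L k : ℕ} {S : ℕ}

/-- the image gradient of a source-localized operator: cost `e^{δ}` (the backward shift) — both cases `ν ∈ T`, `ν ∉ T`. [folklore] -/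
theorem hasMaj_gradImg_comp {T' : (Tor (fine n M) × Fin (d + 1) → ℝ) →ₗ[ℝ] (Tor (fine n M) × Fin (d + 1) → ℝ)} {C δ : ℝ} (hC : 0 ≤ C) (hδ : 0 ≤ δ) (ν : Fin (d + 1))
    (Ts : Finset (Fin (d + 1))) (cc : ℝ)
    (h : HasMaj (BlockNorm.ofBlocks (unitTorusGeo L k M) (fun b : Tor (fine n M) × Fin (d + 1) => blockOf n M b.1))
      (BlockNorm.ofBlocks (unitTorusGeo L k M) (fun b : Tor (fine n M) × Fin (d + 1) => blockOf n M b.1)) (symbOp M n (sD M n ν cc) ∘ₗ T')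
      (fun y y' => C * Real.exp (-(δ * tdistT M y y')))) :
    HasMaj (BlockNorm.ofBlocks (unitTorusGeo L k M) (fun b : Tor (fine n M) × Fin (d + 1) => blockOf n M b.1))
      (BlockNorm.ofBlocks (unitTorusGeo L k M) (fun b : Tor (fine n M) × Fin (d + 1) => blockOf n M b.1)) (gradImg M n ν Ts cc ∘ₗ T')
      (fun y y' => C * Real.exp δ * Real.exp (-(δ * tdistT M y y'))) := by
  unfold gradImg
  split_ifs with hν
  · rw [LinearMap.neg_comp, LinearMap.comp_assoc]
    exact (hasMaj_bshiftV_comp M k n hC hδ ν h).neg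
  · refine h.mono fun y y' => ?_
    have h1 : (1 : ℝ) ≤ Real.exp δ := Real.one_le_exp hδ
    have h2 : 0 ≤ C * Real.exp (-(δ * tdistT M y y')) := mul_nonneg hC (Real.exp_nonneg _)
    nlinarith

variable [NeZero L]

/-- ★★★ **ENTRY 1 OF THE NEUMANN CUBE PROPAGATOR AT `U ≡ 1`**: for odd `L > 1`, `a > 0` there are `δ, β > 0` with, for EVERY `m, K ≥ 1`, cube position `c` and direction `ν`,
`χ_□ ∘ ∇_ν ∘ G(□ + c)` (`∇_ν = ρ(sD_ν L^K)`, the unit-normalised forward difference of (1.110)) has the block majorant `1_□(y)·1_□(y′)·β·e^{−δ|y−y′|_T}` — from the (1.110) entry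
«∇G» of the torus propagator (`hasMaj_entries110`) by the method of images (`β = 2^{d+1}·C·e^{2δ₀}`). [cite: Balaban1984PropagatorsII, (2.133) p.247 (shape); Balaban1984PropagatorsI, Prop. 1.2 (1.110) p.35] -/
theorem hasMaj_chiCube_grad_neumannCubeG (hL : Odd L ∧ 1 < L) {a : ℝ} (ha : 0 < a) :
    ∃ δ β : ℝ, 0 < δ ∧ 0 < β ∧ ∀ (m K : ℕ) (hK : 1 ≤ K) (c : Tor (MP (paramsOf d L m K hL))) (ν : Fin (d + 1)),
      HasMaj (BlockNorm.ofBlocks (unitTorusGeo L K (MP (paramsOf d L m K hL))) (blkFine L K (MP (paramsOf d L m K hL))))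
        (BlockNorm.ofBlocks (unitTorusGeo L K (MP (paramsOf d L m K hL))) (blkFine L K (MP (paramsOf d L m K hL))))
        (mulOp (chiCube (MP (paramsOf d L m K hL)) (L ^ K) c (L ^ m)) ∘ₗ
          symbOp (MP (paramsOf d L m K hL)) (L ^ K) (sD (MP (paramsOf d L m K hL)) (L ^ K) ν ((L ^ K : ℕ) : ℝ)) ∘ₗ
          neumannCubeG (MP (paramsOf d L m K hL)) (L ^ K) c (L ^ m) a)
        (fun y y' => ind ((cubeBlocks (MP (paramsOf d L m K hL)) c (L ^ m) : Finset _) : Set _) y *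
          ind ((cubeBlocks (MP (paramsOf d L m K hL)) c (L ^ m) : Finset _) : Set _) y' *
          (β * Real.exp (-(δ * tdistT (MP (paramsOf d L m K hL)) y y')))) := by
  obtain ⟨δ₀, C, hδ₀, hC, H⟩ := hasMaj_entries110 (d := d) hL ha
  refine ⟨δ₀, 2 ^ (d + 1) * (C * Real.exp δ₀ * Real.exp δ₀), hδ₀, by positivity, fun m K hK c ν => ?_⟩
  have hM : ∀ μ, MP (paramsOf d L m K hL) μ = 2 * L ^ m := fun μ => rfl
  have hD := (H m K hK ν).1
  -- per image: `∇^{(T)} ∘ G ∘ χ°` source-localized with cost `e^{δ₀}`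
  have hT : ∀ Ts : Finset (Fin (d + 1)),
      HasMaj (BlockNorm.ofBlocks (unitTorusGeo L K (MP (paramsOf d L m K hL))) (blkFine L K (MP (paramsOf d L m K hL))))
        (BlockNorm.ofBlocks (unitTorusGeo L K (MP (paramsOf d L m K hL))) (blkFine L K (MP (paramsOf d L m K hL))))
        (gradImg (MP (paramsOf d L m K hL)) (L ^ K) ν Ts ((L ^ K : ℕ) : ℝ) ∘ₗ (gOp (MP (paramsOf d L m K hL)) (L ^ K) a ∘ₗ
          mulOp (chiInt (MP (paramsOf d L m K hL)) (L ^ K) c (L ^ m))))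
        (fun y y' => ind ((cubeBlocks (MP (paramsOf d L m K hL)) c (L ^ m) : Finset _) : Set _) y' * (C * Real.exp δ₀ * Real.exp (-(δ₀ * tdistT (MP (paramsOf d L m K hL)) y y')))) := by
    intro Ts
    have h1 := hasMaj_comp_mulOp_chiInt (c := c) (S := L ^ m) hC.le hD
    -- `h1` is localized at the source; feed the unlocalized shape to `hasMaj_gradImg_comp` per source block
    intro y' μ hμ y
    by_cases hy' : y' ∈ cubeBlocks (MP (paramsOf d L m K hL)) c (L ^ m)
    · have hi : ind ((cubeBlocks (MP (paramsOf d L m K hL)) c (L ^ m) : Finset _) : Set _) y' = 1 := by simp [ind, hy']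
      have hloc : HasMaj (BlockNorm.ofBlocks (unitTorusGeo L K (MP (paramsOf d L m K hL))) (blkFine L K (MP (paramsOf d L m K hL))))
          (BlockNorm.ofBlocks (unitTorusGeo L K (MP (paramsOf d L m K hL))) (blkFine L K (MP (paramsOf d L m K hL))))
          (symbOp (MP (paramsOf d L m K hL)) (L ^ K) (sD (MP (paramsOf d L m K hL)) (L ^ K) ν ((L ^ K : ℕ) : ℝ)) ∘ₗ
            (gOp (MP (paramsOf d L m K hL)) (L ^ K) a ∘ₗ mulOp (chiInt (MP (paramsOf d L m K hL)) (L ^ K) c (L ^ m))))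
          (fun y y' => C * Real.exp (-(δ₀ * tdistT (MP (paramsOf d L m K hL)) y y'))) := by
        -- the localized bound implies the unlocalized one only up to the indicator; we use it at THIS `y'` below instead
        intro z' μ' hμ' z
        have := h1 z' μ' hμ' z
        simp only [LinearMap.comp_apply] at this ⊢
        exact this.trans (mul_le_mul_of_nonneg_right (mul_le_of_le_one_left (mul_nonneg hC.le (Real.exp_nonneg _)) (ind_le_one _ _))
          ((BlockNorm.ofBlocks _ _).loc_nonneg z' μ'))
      have h3 := hasMaj_gradImg_comp (L := L) (k := K) (T' := gOp (MP (paramsOf d L m K hL)) (L ^ K) a ∘ₗ mulOp (chiInt (MP (paramsOf d L m K hL)) (L ^ K) c (L ^ m)))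
        (C := C) hC.le hδ₀.le ν Ts ((L ^ K : ℕ) : ℝ) hloc
      have := h3 y' μ hμ y
      dsimp only at this ⊢
      rw [hi, one_mul]
      exact this
    · have hi : ind ((cubeBlocks (MP (paramsOf d L m K hL)) c (L ^ m) : Finset _) : Set _) y' = 0 := by simp [ind, hy']
      have hzero : mulOp (chiInt (MP (paramsOf d L m K hL)) (L ^ K) c (L ^ m)) μ = 0 := by
        funext b
        rw [mulOp_apply, Pi.zero_apply]
        by_cases hb : blkFine L K (MP (paramsOf d L m K hL)) b = y'
        · have : b ∉ intBonds (MP (paramsOf d L m K hL)) (L ^ K) c (L ^ m) := fun h => hy' (hb ▸ blockOf_mem_cubeBlocks h)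
          rw [chiInt_of_not_intBond this, zero_mul]
        · rw [hμ b hb, mul_zero]
      dsimp only
      rw [LinearMap.comp_apply, LinearMap.comp_apply, hzero, map_zero, map_zero, (BlockNorm.ofBlocks _ _).loc_zero, hi]
      simp
  have hsum := hasMaj_finsum (Finset.univ : Finset (Fin (d + 1))).powerset _ _ fun Ts _ =>
    hasMaj_chiCube_reflSet_comp (c := c) (S := L ^ m) (by positivity : (0 : ℝ) ≤ C * Real.exp δ₀) hδ₀.le hM Ts (hT Ts)
  rw [neumannCubeG, mulOp_comp_sD_comp_symOp_comp]
  refine hsum.mono fun y y' => le_of_eq ?_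
  rw [Finset.sum_const, Finset.card_powerset, Finset.card_univ, Fintype.card_fin, nsmul_eq_mul]
  push_cast
  simp only [pow_succ, mul_assoc, mul_comm, mul_left_comm]
  rfl

end Gradient


end Summit.QuantumFields.YangMills.BalabanUVNodes.N15.TwoGrid
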